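import Literature.Computability.QuantumComplexity.PauliPathTruncationClassXEB
import HarnessLib

/-!
# The XEB gap of the honest noisy device over its own Pauli-path truncation, and the truncation error

Topic `Literature/Computability/QuantumComplexity`, sub-namespace `PauliPath`; sequel of
`PauliPathXEBEnumerator` (`avgXEB_add_one_eq_weightEnumerator`), `PauliPathOrthogonality`
(`sum_frame_sum_sq_sub_truncValue_eq_sum_fourierWeight`) and `PauliPathTruncationClassXEB`
(`avgClassXEB_add_one`), in the finite Pauli-frame model of a FIXED layer sequence (AGLLV23
Definition 3, uniform frames; general gate-random ensembles are mixtures of such families).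

HONEST FRAMING. Everything below is an exact identity or an elementary inequality (power exchange,
Cauchy–Schwarz in the weights) between three FRAME-AVERAGED numbers attached to one layer sequence `U`,
one basis input `y`, one rate `γ`, one level `ℓ`: the honest noisy device's mean XEB score against its
ideal distribution (`avgXEB γ`), the mean XEB score that AGLLV23's level-`ℓ` truncation `q̄_ℓ` (the
signed linear path sum `truncValue`; the member `a_s = (1−γ)^{|s|}` of `avgClassXEB`) receives against
the same ideal distribution, and the `2ⁿ`-normalised MEAN-SQUARE error of that truncation
(`truncErr γ ℓ`). Means over the frame ensemble and the `ℓ²` error only; conversions to the `L¹` error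
of a typical frame are the tree's `avg_frame_l1TruncError_le` (Jensen) and
`card_frame_l1TruncError_ge_mul_sq_le` (Markov), not restated. A hypothesis `avgXEB γ U y ≤ χ` is an
UPPER bound on the MEAN honest score, a visible binder; nothing is inferred from observed samples. No
running time, sampler or simulation cost is asserted; nothing here proves or refutes a quantum advantage.

RECORDED (`n = |ι|`, `W_k ≥ 0` the noiseless Fourier weights, `Φ_{>ℓ}(t) := Σ_{ℓ<k≤n(d+1)} t^k W_k`
= `tailEnum t ℓ`, `α′ = avgXEB 0`): **(E1)** `truncErr γ ℓ = Φ_{>ℓ}((1−γ)²)`, **(E2)**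
`xebGap γ ℓ = Φ_{>ℓ}(1−γ)` (any layer matrices, any real `γ`); **(T1)** `truncErr ≤ (1−γ)^{ℓ+1}·xebGap`
(any layers, `0 ≤ γ ≤ 1`) — with `xebGap ≤ (1−γ)^{ℓ+1}Φ_{>ℓ}(1) ≤ (1−γ)^{ℓ+1}α′` it refines the tree's
damping bound `sum_frame_sum_norm_sq_sub_truncValue_le`; **(T2)** `xebGap² ≤ Φ_{>ℓ}(1)·truncErr ≤
α′·truncErr` (any layers, any real `γ`); **(T3)** the readings `avgXEB_le_avgClassXEB_add_sqrt`
(`truncErr ≤ ε` ⟹ mean honest score ≤ the truncation's mean score `+ √(α′ε)`),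
`truncErr_le_of_xebGap_le`, and the sub-depth collapse (unitary, `ℓ ≤ d`): `xebGap = avgXEB γ`,
`truncErr γ ℓ = truncErr γ 0 =: U_γ` (distance from uniform, `truncValue_zero_frame_eq`),
`subDepthSandwich` `(avgXEB γ)² ≤ α′U_γ`, `U_γ ≤ (1−γ)^{d+1} avgXEB γ`; **(T4)** a mean-score bound `χ`
with `(1−γ)^{ℓ+1}χ ≤ ε`, resp. `γ(ℓ+1) ≥ log(χ/ε)`, gives `truncErr γ ℓ ≤ ε` (`χ` in the rôle of
`α′ + 1` in `agllvSufficientLevel`); **(S)** `endpointRows` (`γ ∈ {0,1}`, `ℓ ≥ n(d+1)`); **(N1)**.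

NOT recorded elsewhere in the tree: `certificateLevelDichotomy` / `agllvSufficientLevel`
(`PauliPathXEBEnumerator`) multiply two separate `α′`-bounds and never see the gap;
`truncationClassCeiling(CS)` / `positivityCap` / `subDepthTruncationScore` (`PauliPathTruncationClassXEB`)
compare truncation-class scores with the IDEAL score, never with the truncation error; `FrameAvgL2` /
`FrameBadFraction` (`PauliPathL2Window`) and `frameL2Floor_depolarizing` (`PauliPathLetterXEB`) bound the
single-observable frame error by ideal `ℓ²` masses; `WeightTruncationErrorBudget` is budget algebra.
The combination (T1)–(T4) is elementary and is recorded for the cell line `xeb-gap-truncation-sandwich`,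
not attributed: cite tags name the printed displays being combined.

## References

* [AharonovEtAl2023] D. Aharonov, X. Gao, Z. Landau, Y. Liu, U. Vazirani, *A polynomial-time classical
  algorithm for noisy random circuit sampling*, STOC 2023, 945–957, arXiv:2211.03999 — §2 (Lemmas 3–4,
  Definition 5), §3–§3.1 (the truncation `q̄`, the `E[Δ²]` chain), §3.3, §5 (XEB display, Theorem 4).
-/

noncomputable section

open Matrix Finset

namespace Literature.Computability.QuantumComplexity

namespace PauliPath

variable {ι : Type*} [Fintype ι] [DecidableEq ι]

omit [DecidableEq ι] in
/-- The sign characters are real. [cite: AharonovEtAl2023, §2 (proof of Lemma 2: V P V† = ±P)] -/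
private theorem conj_strSign_gap (W S : ι → Pauli) : (starRingEnd ℂ) (strSign W S) = strSign W S := by
  rw [strSign_eq, map_prod]
  exact Finset.prod_congr rfl fun i _ => by unfold Pauli.sign; split_ifs <;> simp

omit [Fintype ι] [DecidableEq ι] in
/-- A real complex number squared is the cast of its squared modulus. [cite: AharonovEtAl2023, §2 (f(C,s,x) ∈ ℝ)] -/
private theorem sq_eq_ofReal_norm_sq_gap {z : ℂ} (hz : (starRingEnd ℂ) z = z) :
    z ^ 2 = ((‖z‖ ^ 2 : ℝ) : ℂ) := by
  obtain ⟨t, rfl⟩ : ∃ t : ℝ, (t : ℂ) = z := ⟨z.re, Complex.conj_eq_iff_re.mp hz⟩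
  rw [Complex.norm_real, Real.norm_eq_abs, sq_abs]
  push_cast
  ring

/-- `p̃_W(x) − q̄_{ℓ,W}(x)` is real on a basis input at a real rate. [cite: AharonovEtAl2023, §3.1 and §2 (f(C,s,x) ∈ ℝ)] -/
private theorem conj_sub_truncValue_frame_proj (γ : ℝ) (ℓ : ℕ) {d : ℕ}
    (U : Fin d → Matrix (ι → Bool) (ι → Bool) ℂ) (W : Fin (d + 1) → ι → Pauli) (y x : ι → Bool) :
    (starRingEnd ℂ) (noisyValue (γ : ℂ) (frameLayers U W) (proj y) (frameObs (proj x) W) -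
        truncValue (γ : ℂ) ℓ (frameLayers U W) (proj y) (frameObs (proj x) W)) =
      noisyValue (γ : ℂ) (frameLayers U W) (proj y) (frameObs (proj x) W) -
        truncValue (γ : ℂ) ℓ (frameLayers U W) (proj y) (frameObs (proj x) W) := by
  rw [noisyValue_sub_truncValue, map_sum]
  refine Finset.sum_congr rfl fun s _ => ?_
  rw [pathCoeff_frame, map_mul, map_prod,
    conj_pathCoeff_ofReal γ U (conjTranspose_proj y) (conjTranspose_proj x)]
  congr 1
  exact Finset.prod_congr rfl fun t _ => conj_strSign_gap _ _

/-- The HIGH TAIL of the weight enumerator, `Φ_{>ℓ}(t) := Σ_{ℓ < k ≤ n(d+1)} t^k W_k` (the terms of the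
Fourier-weight polynomial not kept at level `ℓ`). [cite: AharonovEtAl2023, §5 (display before Theorem 4) and §3.1 (Σ_{k>ℓ})] -/
def tailEnum (t : ℝ) (ℓ : ℕ) {d : ℕ} (U : Fin d → Matrix (ι → Bool) (ι → Bool) ℂ)
    (y x₀ : ι → Bool) : ℝ :=
  ∑ k ∈ (Finset.range (Fintype.card ι * (d + 1) + 1)).filter (fun k => ℓ < k), t ^ k * wt U y x₀ k

/-- The frame-averaged `2ⁿ`-normalised MEAN-SQUARE ERROR of the level-`ℓ` truncation of the honest
`γ`-noisy output on `|y⟩⟨y|`: `2ⁿ · E_W Σ_x |p̃_W(x) − q̄_{ℓ,W}(x)|²`. [cite: AharonovEtAl2023, §3.1 (E[Δ²] chain, first line)] -/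
def truncErr (γ : ℝ) (ℓ : ℕ) {d : ℕ} (U : Fin d → Matrix (ι → Bool) (ι → Bool) ℂ) (y : ι → Bool) : ℝ :=
  (2 : ℝ) ^ Fintype.card ι * (∑ W : Fin (d + 1) → ι → Pauli, ∑ x : ι → Bool,
      ‖noisyValue (γ : ℂ) (frameLayers U W) (proj y) (frameObs (proj x) W) -
        truncValue (γ : ℂ) ℓ (frameLayers U W) (proj y) (frameObs (proj x) W)‖ ^ 2) / frameCount ι d

/-- The XEB GAP: mean honest noisy score minus the mean score of its own level-`ℓ` truncation `q̄_ℓ`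
(member `a_s = (1−γ)^{|s|}` of `avgClassXEB`; `pathEstimator_pow_eq_truncValue_re`). [cite: AharonovEtAl2023, §5 (display before Theorem 4) and §3 (display: p̃ ≈ Σ_{|s|≤ℓ} f̃)] -/
def xebGap (γ : ℝ) (ℓ : ℕ) {d : ℕ} (U : Fin d → Matrix (ι → Bool) (ι → Bool) ℂ) (y : ι → Bool) : ℝ :=
  avgXEB γ U y - avgClassXEB ℓ (fun s => (1 - γ) ^ pathWeight s) U y

/-- `Φ_{>ℓ}(t) ≥ 0` for `t ≥ 0`. [cite: AharonovEtAl2023, Definition 5 (W_k ≥ 0)] -/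
theorem tailEnum_nonneg {t : ℝ} (ht : 0 ≤ t) (ℓ : ℕ) {d : ℕ}
    (U : Fin d → Matrix (ι → Bool) (ι → Bool) ℂ) (y x₀ : ι → Bool) : 0 ≤ tailEnum t ℓ U y x₀ :=
  Finset.sum_nonneg fun k _ => mul_nonneg (pow_nonneg ht _) (wt_nonneg U y x₀ k)

/-- **Power exchange**: `Φ_{>ℓ}(ab) ≤ a^{ℓ+1} Φ_{>ℓ}(b)` for `0 ≤ a ≤ 1`, `b ≥ 0` (term-wise
`(ab)^k = a^k b^k ≤ a^{ℓ+1} b^k` for `k > ℓ`). [cite: AharonovEtAl2023, §3.1 (display after the E[Δ²] chain: the damping step)] -/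
theorem tailEnum_mul_le {a b : ℝ} (ha0 : 0 ≤ a) (ha1 : a ≤ 1) (hb : 0 ≤ b) (ℓ : ℕ) {d : ℕ}
    (U : Fin d → Matrix (ι → Bool) (ι → Bool) ℂ) (y x₀ : ι → Bool) :
    tailEnum (a * b) ℓ U y x₀ ≤ a ^ (ℓ + 1) * tailEnum b ℓ U y x₀ := by
  rw [tailEnum, tailEnum, Finset.mul_sum]
  refine Finset.sum_le_sum fun k hk => ?_
  rw [mul_pow, mul_assoc]
  exact mul_le_mul_of_nonneg_right (pow_le_pow_of_le_one ha0 ha1 (Finset.mem_filter.1 hk).2)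
    (mul_nonneg (pow_nonneg hb _) (wt_nonneg U y x₀ k))

/-- **Cauchy–Schwarz in the weights**: `Φ_{>ℓ}(t)² ≤ Φ_{>ℓ}(1) · Φ_{>ℓ}(t²)` for every real `t`.
[cite: AharonovEtAl2023, Definition 5 (W_k ≥ 0) and §3.1 (first line: Cauchy–Schwarz)] -/
theorem tailEnum_sq_le_mul (t : ℝ) (ℓ : ℕ) {d : ℕ} (U : Fin d → Matrix (ι → Bool) (ι → Bool) ℂ)
    (y x₀ : ι → Bool) :
    tailEnum t ℓ U y x₀ ^ 2 ≤ tailEnum 1 ℓ U y x₀ * tailEnum (t ^ 2) ℓ U y x₀ := by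
  unfold tailEnum
  exact Finset.sum_sq_le_sum_mul_sum_of_sq_le_mul _
    (fun k _ => mul_nonneg (pow_nonneg zero_le_one _) (wt_nonneg U y x₀ k))
    (fun k _ => mul_nonneg (pow_nonneg (sq_nonneg t) _) (wt_nonneg U y x₀ k))
    fun k _ => le_of_eq (by ring)

/-- `Φ_{>ℓ}(t) = 0` once `ℓ ≥ n(d+1)` (nothing is truncated). [cite: AharonovEtAl2023, §3.2 (n(d+1) locations)] -/
theorem tailEnum_eq_zero_of_le (t : ℝ) {ℓ d : ℕ} (hℓ : Fintype.card ι * (d + 1) ≤ ℓ)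
    (U : Fin d → Matrix (ι → Bool) (ι → Bool) ℂ) (y x₀ : ι → Bool) : tailEnum t ℓ U y x₀ = 0 := by
  refine Finset.sum_eq_zero fun k hk => ?_
  obtain ⟨hk1, hk2⟩ := Finset.mem_filter.1 hk
  have := Finset.mem_range.1 hk1
  omega

/-- `Φ_{>ℓ}(0) = 0`. [cite: AharonovEtAl2023, §5 (γ = 1: fully depolarised)] -/
theorem tailEnum_zero_left (ℓ : ℕ) {d : ℕ} (U : Fin d → Matrix (ι → Bool) (ι → Bool) ℂ)
    (y x₀ : ι → Bool) : tailEnum 0 ℓ U y x₀ = 0 :=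
  Finset.sum_eq_zero fun k hk => by
    rw [zero_pow (lt_of_le_of_lt (Nat.zero_le ℓ) (Finset.mem_filter.1 hk).2).ne', zero_mul]

/-- **The level-`0` tail is the honest score**, `Φ_{>0}(1−γ) = E_W XEB_γ` (unitary layers).
[cite: AharonovEtAl2023, §5 (display before Theorem 4: XEB = Σ_{k>0} (1−γ)^k W_k)] -/
theorem tailEnum_zero_eq_avgXEB (γ : ℝ) {d : ℕ} {U : Fin d → Matrix (ι → Bool) (ι → Bool) ℂ}
    (hU : ∀ t, U t ∈ Matrix.unitaryGroup (ι → Bool) ℂ) (y x₀ : ι → Bool) :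
    tailEnum (1 - γ) 0 U y x₀ = avgXEB γ U y := by
  rw [avgXEB_eq_sum_erase γ hU y x₀, tailEnum]
  refine Finset.sum_congr ?_ fun _ _ => rfl
  ext k
  simp only [Finset.mem_filter, Finset.mem_erase, Finset.mem_range, ne_eq]
  omega

/-- **Legality band**: every level `ℓ ≤ d` has the tail of level `0` (unitary layers: `W_k = 0`, `0 < k ≤ d`). [cite: AharonovEtAl2023, Lemma 4 (item 2)] -/
theorem tailEnum_eq_tailEnum_zero_of_le (t : ℝ) {ℓ d : ℕ} (hℓ : ℓ ≤ d)
    {U : Fin d → Matrix (ι → Bool) (ι → Bool) ℂ} (hU : ∀ t, U t ∈ Matrix.unitaryGroup (ι → Bool) ℂ)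
    (y x₀ : ι → Bool) : tailEnum t ℓ U y x₀ = tailEnum t 0 U y x₀ := by
  simp only [tailEnum, Finset.sum_filter]
  refine Finset.sum_congr rfl fun k _ => ?_
  by_cases hk : ℓ < k
  · rw [if_pos hk, if_pos (by omega)]
  · by_cases hk0 : k = 0
    · subst hk0
      rw [if_neg hk, if_neg (lt_irrefl 0)]
    · rw [if_neg hk, if_pos (Nat.pos_of_ne_zero hk0), wt_eq_zero_of_le hU y x₀ hk0 (by omega),
        mul_zero]

/-- `Φ_{>ℓ}(1−γ) ≤ Φ_{>0}(1−γ) = E_W XEB_γ` (unitary layers, `γ ≤ 1`; the tail is antitone in the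
level). [cite: AharonovEtAl2023, §5 (display before Theorem 4) and Definition 5] -/
theorem tailEnum_le_avgXEB {γ : ℝ} (h1 : γ ≤ 1) (ℓ : ℕ) {d : ℕ}
    {U : Fin d → Matrix (ι → Bool) (ι → Bool) ℂ} (hU : ∀ t, U t ∈ Matrix.unitaryGroup (ι → Bool) ℂ)
    (y x₀ : ι → Bool) : tailEnum (1 - γ) ℓ U y x₀ ≤ avgXEB γ U y := by
  rw [← tailEnum_zero_eq_avgXEB γ hU y x₀]
  refine Finset.sum_le_sum_of_subset_of_nonneg (fun k hk => ?_)
    fun k _ _ => mul_nonneg (pow_nonneg (by linarith) _) (wt_nonneg U y x₀ k)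
  rw [Finset.mem_filter] at hk ⊢
  exact ⟨hk.1, lt_of_le_of_lt (Nat.zero_le ℓ) hk.2⟩

/-- The high-degree Fourier MASS is at most `α′`: `Φ_{>ℓ}(1) ≤ E_W XEB_0` (unitary layers). [cite: AharonovEtAl2023, Lemma 4 and Definition 5] -/
theorem tailEnum_one_le_avgXEB_zero (ℓ : ℕ) {d : ℕ} {U : Fin d → Matrix (ι → Bool) (ι → Bool) ℂ}
    (hU : ∀ t, U t ∈ Matrix.unitaryGroup (ι → Bool) ℂ) (y x₀ : ι → Bool) :
    tailEnum 1 ℓ U y x₀ ≤ avgXEB 0 U y := by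
  simpa only [sub_zero] using tailEnum_le_avgXEB (le_of_lt one_pos) ℓ hU y x₀

/-- **(E1)** `truncErr γ ℓ = Φ_{>ℓ}((1−γ)²)` — the real cast of the tree's
`sum_frame_sum_sq_sub_truncValue_eq_sum_fourierWeight` (any layer matrices, any basis input `y`, any
reference output `x₀`, any real `γ`). [cite: AharonovEtAl2023, §3.1 (E[Δ²] chain: "= Σ_{k>ℓ} (1−γ)^{2k} W_k")] -/
theorem truncErr_eq_tailEnum (γ : ℝ) (ℓ : ℕ) {d : ℕ} (U : Fin d → Matrix (ι → Bool) (ι → Bool) ℂ)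
    (y x₀ : ι → Bool) : truncErr γ ℓ U y = tailEnum ((1 - γ) ^ 2) ℓ U y x₀ := by
  have hC := sum_frame_sum_sq_sub_truncValue_eq_sum_fourierWeight (γ : ℂ) ℓ U (proj y) x₀
  simp_rw [fun W x => sq_eq_ofReal_norm_sq_gap (conj_sub_truncValue_frame_proj γ ℓ U W y x)] at hC
  have hR : ((frameCount ι d * tailEnum ((1 - γ) ^ 2) ℓ U y x₀ : ℝ) : ℂ) =
      ((4 : ℂ) ^ Fintype.card ι) ^ (d + 1) *
        ∑ k ∈ (Finset.range (Fintype.card ι * (d + 1) + 1)).filter (fun k => ℓ < k),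
          ((1 - (γ : ℂ)) ^ 2) ^ k * fourierWeight 0 U (proj y) x₀ k := by
    unfold frameCount tailEnum
    push_cast
    simp_rw [ofReal_wt]
  rw [truncErr, div_eq_iff (frameCount_pos ι d).ne', mul_comm (tailEnum _ _ _ _ _)]
  exact_mod_cast hC.trans hR.symm

/-- `truncErr ≥ 0`. [cite: AharonovEtAl2023, §3.1 (E[Δ²])] -/
theorem truncErr_nonneg (γ : ℝ) (ℓ : ℕ) {d : ℕ} (U : Fin d → Matrix (ι → Bool) (ι → Bool) ℂ)
    (y : ι → Bool) : 0 ≤ truncErr γ ℓ U y := by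
  rw [truncErr_eq_tailEnum γ ℓ U y y]
  exact tailEnum_nonneg (sq_nonneg _) ℓ U y y

/-- The member `a_s = (1−γ)^{|s|}` of the truncation class IS the truncation `q̄_ℓ` at rate `γ`:
`q_{a,W}(x) = Re q̄_{ℓ,W}(x)` (`f̃ = (1−γ)^{|s|} f`; any layer matrices). [cite: AharonovEtAl2023, §3 (display: p̃ ≈ Σ_{|s|≤ℓ} f̃(C,s,x)) and §2 (display after Definition 2)] -/
theorem pathEstimator_pow_eq_truncValue_re (γ : ℝ) (ℓ : ℕ) {d : ℕ}
    (U : Fin d → Matrix (ι → Bool) (ι → Bool) ℂ) (y : ι → Bool) (W : Fin (d + 1) → ι → Pauli)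
    (x : ι → Bool) :
    pathEstimator ℓ (fun s => (1 - γ) ^ pathWeight s) U y W x =
      (truncValue (γ : ℂ) ℓ (frameLayers U W) (proj y) (frameObs (proj x) W)).re := by
  rw [pathEstimator, truncValue]
  congr 1
  refine Finset.sum_congr rfl fun s _ => ?_
  rw [pathCoeff_eq_pow_mul_pathCoeff_zero (γ : ℂ) (frameLayers U W) (proj y) (frameObs (proj x) W) s]
  push_cast
  ring

/-- Regrouping a damped low path sum by degree: `Σ_{|s|≤ℓ} t^{|s|} w_s = Σ_{k≤ℓ} t^k W_k`.
[cite: AharonovEtAl2023, Definition 5 (W_k = Σ_{|s|=k})] -/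
theorem sum_filter_le_pow_mul_pathWt (t : ℝ) (ℓ : ℕ) {d : ℕ}
    (U : Fin d → Matrix (ι → Bool) (ι → Bool) ℂ) (y x₀ : ι → Bool) :
    ∑ s ∈ Finset.univ.filter (fun s : Fin (d + 1) → ι → Pauli => pathWeight s ≤ ℓ),
        t ^ pathWeight s * pathWt U y x₀ s =
      ∑ k ∈ (Finset.range (Fintype.card ι * (d + 1) + 1)).filter (fun k => ¬ ℓ < k),
        t ^ k * wt U y x₀ k := by
  rw [← Finset.sum_fiberwise_of_maps_to
    (s := Finset.univ.filter (fun s : Fin (d + 1) → ι → Pauli => pathWeight s ≤ ℓ))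
    (t := (Finset.range (Fintype.card ι * (d + 1) + 1)).filter (fun k => ¬ ℓ < k))
    (g := pathWeight) (f := fun s => t ^ pathWeight s * pathWt U y x₀ s)
    (fun s hs => Finset.mem_filter.2 ⟨Finset.mem_range.2 (Nat.lt_succ_of_le (pathWeight_le s)),
      not_lt.2 (Finset.mem_filter.1 hs).2⟩)]
  refine Finset.sum_congr rfl fun k hk => ?_
  have hkℓ : k ≤ ℓ := not_lt.1 (Finset.mem_filter.1 hk).2
  rw [wt_eq_sum_pathWt, Finset.mul_sum, Finset.filter_filter]
  refine Finset.sum_congr ?_ fun s hs => by rw [(Finset.mem_filter.1 hs).2]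
  ext s
  simp only [Finset.mem_filter, Finset.mem_univ, true_and]
  exact ⟨fun h => h.2, fun h => ⟨by rw [h]; exact hkℓ, h⟩⟩

/-- **(E2, the truncation's score)** `E_W XEB(q̄_{ℓ,W}; p_W) + 1 = Φ(1−γ) − Φ_{>ℓ}(1−γ) = Σ_{k≤ℓ}(1−γ)^k W_k`
(any layer matrices, any real `γ`). [cite: AharonovEtAl2023, Lemma 3 and §5 (display before Theorem 4)] -/
theorem avgClassXEB_pow_add_one (γ : ℝ) (ℓ : ℕ) {d : ℕ} (U : Fin d → Matrix (ι → Bool) (ι → Bool) ℂ)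
    (y x₀ : ι → Bool) :
    avgClassXEB ℓ (fun s => (1 - γ) ^ pathWeight s) U y + 1 =
      weightEnumerator (1 - γ) U y x₀ - tailEnum (1 - γ) ℓ U y x₀ := by
  rw [avgClassXEB_add_one ℓ _ U y x₀, weightEnumerator, tailEnum,
    ← Finset.sum_filter_add_sum_filter_not (Finset.range _) (fun k => ℓ < k), add_sub_cancel_left]
  exact sum_filter_le_pow_mul_pathWt (1 - γ) ℓ U y x₀

/-- **(E2)** `xebGap γ ℓ = Φ_{>ℓ}(1−γ)` (any layer matrices, any `y`, `x₀`, any real `γ`): honest score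
`Φ(1−γ) − 1` minus truncation score `Φ(1−γ) − Φ_{>ℓ}(1−γ) − 1`. [cite: AharonovEtAl2023, §5 (display before Theorem 4) and §3.1] -/
theorem xebGap_eq_tailEnum (γ : ℝ) (ℓ : ℕ) {d : ℕ} (U : Fin d → Matrix (ι → Bool) (ι → Bool) ℂ)
    (y x₀ : ι → Bool) : xebGap γ ℓ U y = tailEnum (1 - γ) ℓ U y x₀ := by
  rw [xebGap]
  linarith [avgXEB_add_one_eq_weightEnumerator γ U y x₀, avgClassXEB_pow_add_one γ ℓ U y x₀]

/-- `xebGap ≥ 0` for `γ ≤ 1` (any layer matrices). [cite: AharonovEtAl2023, Definition 5 (W_k ≥ 0) and §5] -/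
theorem xebGap_nonneg {γ : ℝ} (h1 : γ ≤ 1) (ℓ : ℕ) {d : ℕ}
    (U : Fin d → Matrix (ι → Bool) (ι → Bool) ℂ) (y : ι → Bool) : 0 ≤ xebGap γ ℓ U y := by
  rw [xebGap_eq_tailEnum γ ℓ U y y]
  exact tailEnum_nonneg (by linarith) ℓ U y y

/-- **(T1) ERROR ≤ DAMPED GAP**: `truncErr γ ℓ ≤ (1−γ)^{ℓ+1} · xebGap γ ℓ` (ANY layer matrices,
`0 ≤ γ ≤ 1`; one tail read at `(1−γ)²` and at `1−γ`). [cite: AharonovEtAl2023, §3.1 (E[Δ²] chain, damping step) and §5 (display before Theorem 4)] -/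
theorem truncErr_le_pow_mul_xebGap {γ : ℝ} (h0 : 0 ≤ γ) (h1 : γ ≤ 1) (ℓ : ℕ) {d : ℕ}
    (U : Fin d → Matrix (ι → Bool) (ι → Bool) ℂ) (y : ι → Bool) :
    truncErr γ ℓ U y ≤ (1 - γ) ^ (ℓ + 1) * xebGap γ ℓ U y := by
  rw [truncErr_eq_tailEnum γ ℓ U y y, xebGap_eq_tailEnum γ ℓ U y y, sq]
  exact tailEnum_mul_le (by linarith) (by linarith) (by linarith) ℓ U y y

/-- **(T1, reading) SMALL GAP ⟹ ACCURATE**: `xebGap γ ℓ ≤ η` gives `truncErr γ ℓ ≤ (1−γ)^{ℓ+1} η` (any layer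
matrices, `0 ≤ γ ≤ 1`). [cite: AharonovEtAl2023, §3.1 and §5] -/
theorem truncErr_le_of_xebGap_le {γ η : ℝ} (h0 : 0 ≤ γ) (h1 : γ ≤ 1) (ℓ : ℕ) {d : ℕ}
    (U : Fin d → Matrix (ι → Bool) (ι → Bool) ℂ) (y : ι → Bool) (hη : xebGap γ ℓ U y ≤ η) :
    truncErr γ ℓ U y ≤ (1 - γ) ^ (ℓ + 1) * η :=
  (truncErr_le_pow_mul_xebGap h0 h1 ℓ U y).trans
    (mul_le_mul_of_nonneg_left hη (pow_nonneg (by linarith) _))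

/-- **(T1′) the printed damping step on the gap**: `xebGap γ ℓ ≤ (1−γ)^{ℓ+1} Φ_{>ℓ}(1)` (any layer
matrices, `0 ≤ γ ≤ 1`). [cite: AharonovEtAl2023, §3.1 (display after the E[Δ²] chain)] -/
theorem xebGap_le_pow_mul_tailEnum_one {γ : ℝ} (h0 : 0 ≤ γ) (h1 : γ ≤ 1) (ℓ : ℕ) {d : ℕ}
    (U : Fin d → Matrix (ι → Bool) (ι → Bool) ℂ) (y x₀ : ι → Bool) :
    xebGap γ ℓ U y ≤ (1 - γ) ^ (ℓ + 1) * tailEnum 1 ℓ U y x₀ := by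
  have h := tailEnum_mul_le (b := 1) (by linarith : 0 ≤ 1 - γ) (by linarith) zero_le_one ℓ U y x₀
  rwa [mul_one, ← xebGap_eq_tailEnum] at h

/-- **(T1″)** chaining: `truncErr γ ℓ ≤ ((1−γ)²)^{ℓ+1} · α′` (unitary layers, `0 ≤ γ ≤ 1`) — the tree's
`sum_frame_sum_norm_sq_sub_truncValue_le` (factor `α′+1`) with the trivial path removed; (T1) is its
gap-valued intermediate. [cite: AharonovEtAl2023, §3.1 (E[Δ²] ≤ O(1)(1−γ)^{2ℓ})] -/
theorem truncErr_le_pow_sq_mul_avgXEB_zero {γ : ℝ} (h0 : 0 ≤ γ) (h1 : γ ≤ 1) (ℓ : ℕ) {d : ℕ}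
    {U : Fin d → Matrix (ι → Bool) (ι → Bool) ℂ} (hU : ∀ t, U t ∈ Matrix.unitaryGroup (ι → Bool) ℂ)
    (y : ι → Bool) : truncErr γ ℓ U y ≤ ((1 - γ) ^ 2) ^ (ℓ + 1) * avgXEB 0 U y :=
  calc truncErr γ ℓ U y ≤ (1 - γ) ^ (ℓ + 1) * ((1 - γ) ^ (ℓ + 1) * avgXEB 0 U y) :=
        truncErr_le_of_xebGap_le h0 h1 ℓ U y ((xebGap_le_pow_mul_tailEnum_one h0 h1 ℓ U y y).trans
          (mul_le_mul_of_nonneg_left (tailEnum_one_le_avgXEB_zero ℓ hU y y)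
            (pow_nonneg (by linarith) _)))
    _ = ((1 - γ) ^ 2) ^ (ℓ + 1) * avgXEB 0 U y := by rw [← pow_mul]; ring

/-- **(T2) GAP² ≤ TAIL MASS · ERROR**: `xebGap γ ℓ ² ≤ Φ_{>ℓ}(1) · truncErr γ ℓ` (ANY layer matrices,
ANY real `γ`; Cauchy–Schwarz in the weights). [cite: AharonovEtAl2023, §3.1 (E[Δ²] chain) and §5 (display before Theorem 4)] -/
theorem xebGap_sq_le_tailEnum_one_mul_truncErr (γ : ℝ) (ℓ : ℕ) {d : ℕ}
    (U : Fin d → Matrix (ι → Bool) (ι → Bool) ℂ) (y x₀ : ι → Bool) :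
    xebGap γ ℓ U y ^ 2 ≤ tailEnum 1 ℓ U y x₀ * truncErr γ ℓ U y := by
  rw [xebGap_eq_tailEnum γ ℓ U y x₀, truncErr_eq_tailEnum γ ℓ U y x₀]
  exact tailEnum_sq_le_mul (1 - γ) ℓ U y x₀

/-- **(T2, unitary form)** `xebGap γ ℓ ² ≤ α′ · truncErr γ ℓ`, `α′ = E_W XEB_0` (unitary layers, any real
`γ`). [cite: AharonovEtAl2023, Lemma 4 and §3.1] -/
theorem xebGap_sq_le_avgXEB_zero_mul_truncErr (γ : ℝ) (ℓ : ℕ) {d : ℕ}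
    {U : Fin d → Matrix (ι → Bool) (ι → Bool) ℂ} (hU : ∀ t, U t ∈ Matrix.unitaryGroup (ι → Bool) ℂ)
    (y : ι → Bool) : xebGap γ ℓ U y ^ 2 ≤ avgXEB 0 U y * truncErr γ ℓ U y :=
  (xebGap_sq_le_tailEnum_one_mul_truncErr γ ℓ U y y).trans
    (mul_le_mul_of_nonneg_right (tailEnum_one_le_avgXEB_zero ℓ hU y y) (truncErr_nonneg γ ℓ U y))

/-- **(T3a) ACCURATE ⟹ NO MEAN XEB MARGIN OVER THE TRUNCATION**: `truncErr γ ℓ ≤ ε` gives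
`E_W XEB(p̃_W; p_W) ≤ E_W XEB(q̄_{ℓ,W}; p_W) + √(α′ε)` (unitary layers, any real `γ`). Means over the
frame ensemble and one signed linear path sum; nothing about any other simulator. [cite: AharonovEtAl2023, §3.1 and §5 (display before Theorem 4)] -/
theorem avgXEB_le_avgClassXEB_add_sqrt {γ ε : ℝ} (ℓ : ℕ) {d : ℕ}
    {U : Fin d → Matrix (ι → Bool) (ι → Bool) ℂ} (hU : ∀ t, U t ∈ Matrix.unitaryGroup (ι → Bool) ℂ)
    (y : ι → Bool) (hε : truncErr γ ℓ U y ≤ ε) :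
    avgXEB γ U y ≤ avgClassXEB ℓ (fun s => (1 - γ) ^ pathWeight s) U y +
      Real.sqrt (avgXEB 0 U y * ε) := by
  have hg : xebGap γ ℓ U y ≤ Real.sqrt (avgXEB 0 U y * ε) :=
    Real.le_sqrt_of_sq_le ((xebGap_sq_le_avgXEB_zero_mul_truncErr γ ℓ hU y).trans
      (mul_le_mul_of_nonneg_left hε (avgXEB_zero_nonneg hU y)))
  rw [xebGap] at hg
  linarith

/-- Below the depth the truncation scores zero and the gap is the whole honest score:
`xebGap γ ℓ = E_W XEB_γ` (unitary layers, `ℓ ≤ d`; the tree's `subDepthTruncationScore`).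
[cite: AharonovEtAl2023, Lemma 4 (items 1–2) and §5] -/
theorem xebGap_eq_avgXEB_of_le (γ : ℝ) {ℓ d : ℕ} (hℓ : ℓ ≤ d)
    {U : Fin d → Matrix (ι → Bool) (ι → Bool) ℂ} (hU : ∀ t, U t ∈ Matrix.unitaryGroup (ι → Bool) ℂ)
    (y : ι → Bool) : xebGap γ ℓ U y = avgXEB γ U y := by
  rw [xebGap, subDepthTruncationScore ℓ hℓ _ hU y]
  simp [pathWeight_eq_zero_iff.2 rfl]

/-- Below the depth the error does not depend on the level: `truncErr γ ℓ = truncErr γ 0` (unitary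
layers, `ℓ ≤ d`). [cite: AharonovEtAl2023, Lemma 4 (item 2) and §3.1] -/
theorem truncErr_eq_truncErr_zero_of_le (γ : ℝ) {ℓ d : ℕ} (hℓ : ℓ ≤ d)
    {U : Fin d → Matrix (ι → Bool) (ι → Bool) ℂ} (hU : ∀ t, U t ∈ Matrix.unitaryGroup (ι → Bool) ℂ)
    (y : ι → Bool) : truncErr γ ℓ U y = truncErr γ 0 U y := by
  rw [truncErr_eq_tailEnum γ ℓ U y y, truncErr_eq_tailEnum γ 0 U y y,
    tailEnum_eq_tailEnum_zero_of_le _ hℓ hU]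

/-- **The level-`0` truncation is the uniform value `2⁻ⁿ` in every frame** (unitary layers, any complex
rate), so `truncErr γ 0 = 2ⁿ·E_W Σ_x |p̃_W(x) − 2⁻ⁿ|²` is the distance from uniform. [cite: AharonovEtAl2023, Lemma 4 (item 1: the all-identity path gives the uniform distribution)] -/
theorem truncValue_zero_frame_eq (γ : ℂ) {d : ℕ} {U : Fin d → Matrix (ι → Bool) (ι → Bool) ℂ}
    (hU : ∀ t, U t ∈ Matrix.unitaryGroup (ι → Bool) ℂ) (y : ι → Bool) (W : Fin (d + 1) → ι → Pauli)
    (x : ι → Bool) :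
    truncValue γ 0 (frameLayers U W) (proj y) (frameObs (proj x) W) = ((2 : ℂ) ^ Fintype.card ι)⁻¹ := by
  have hfil : Finset.univ.filter (fun s : Fin (d + 1) → ι → Pauli => pathWeight s ≤ 0) =
      {fun _ _ => Pauli.I} := by
    ext s
    simp only [Finset.mem_filter, Finset.mem_univ, true_and, Nat.le_zero, pathWeight_eq_zero_iff,
      Finset.mem_singleton]
  rw [truncValue, hfil, Finset.sum_singleton, pathCoeff_frame, pathCoeff_const_I_proj γ hU x y]
  simp [strSign_eq, Pauli.sign]

/-- **(T3c) SUB-DEPTH SANDWICH** (unitary layers, `0 ≤ γ ≤ 1`), `U_γ := truncErr γ 0` the `ℓ²` distance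
from uniform: `(E_W XEB_γ)² ≤ α′ · U_γ` and `U_γ ≤ (1−γ)^{d+1} · E_W XEB_γ` — the ceiling `E_W XEB_γ ≤
(1−γ)^{d+1} α′` (`avgXEB_le_pow_mul`) factors through `U_γ` (the `L¹`, Haar-averaged distance from uniform
is AGLLV23 §6, not used). [cite: AharonovEtAl2023, Theorem 4 (proof, upper bound), Lemma 4 and §6 (Theorem 6)] -/
theorem subDepthSandwich {γ : ℝ} (h0 : 0 ≤ γ) (h1 : γ ≤ 1) {d : ℕ}
    {U : Fin d → Matrix (ι → Bool) (ι → Bool) ℂ} (hU : ∀ t, U t ∈ Matrix.unitaryGroup (ι → Bool) ℂ)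
    (y : ι → Bool) :
    avgXEB γ U y ^ 2 ≤ avgXEB 0 U y * truncErr γ 0 U y ∧
      truncErr γ 0 U y ≤ (1 - γ) ^ (d + 1) * avgXEB γ U y := by
  constructor
  · have h := xebGap_sq_le_avgXEB_zero_mul_truncErr γ 0 hU y
    rwa [xebGap_eq_avgXEB_of_le γ (Nat.zero_le d) hU y] at h
  · have h := truncErr_le_pow_mul_xebGap h0 h1 d U y
    rwa [truncErr_eq_truncErr_zero_of_le γ le_rfl hU y, xebGap_eq_avgXEB_of_le γ le_rfl hU y] at h

/-- **(T4) LEVEL FROM A SCORE BOUND**: an upper bound `χ` on the MEAN honest score (a binder; nothing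
is inferred from samples) and `(1−γ)^{ℓ+1} χ ≤ ε` give `truncErr γ ℓ ≤ ε` (unitary layers, `0 ≤ γ ≤ 1`). [cite: AharonovEtAl2023, §3.1 (E[Δ²] chain) and §5 (display before Theorem 4)] -/
theorem truncErr_le_of_avgXEB_le {γ χ ε : ℝ} (h0 : 0 ≤ γ) (h1 : γ ≤ 1) (ℓ : ℕ) {d : ℕ}
    {U : Fin d → Matrix (ι → Bool) (ι → Bool) ℂ} (hU : ∀ t, U t ∈ Matrix.unitaryGroup (ι → Bool) ℂ)
    (y : ι → Bool) (hχ : avgXEB γ U y ≤ χ) (hℓ : (1 - γ) ^ (ℓ + 1) * χ ≤ ε) :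
    truncErr γ ℓ U y ≤ ε :=
  (truncErr_le_of_xebGap_le h0 h1 ℓ U y (((xebGap_eq_tailEnum γ ℓ U y y).trans_le
    (tailEnum_le_avgXEB h1 ℓ hU y y)).trans hχ)).trans hℓ

/-- **(T4, log form)** given `avgXEB γ ≤ χ`, `γ(ℓ+1) ≥ log(χ/ε)` suffices for `truncErr γ ℓ ≤ ε`
(unitary layers, `0 ≤ γ ≤ 1`, `χ ≥ 0`, `ε > 0`; via `(1−γ)^{ℓ+1} ≤ e^{−γ(ℓ+1)}`).
[cite: AharonovEtAl2023, §3.3 (display: ℓ ≥ γ⁻¹ log(O(1)/(ε√δ))) and §3.1 (eq. (sumoflow))] -/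
theorem truncErr_le_of_log_le {γ χ ε : ℝ} (h0 : 0 ≤ γ) (h1 : γ ≤ 1) (hχ0 : 0 ≤ χ) (hε : 0 < ε)
    (ℓ : ℕ) {d : ℕ} {U : Fin d → Matrix (ι → Bool) (ι → Bool) ℂ}
    (hU : ∀ t, U t ∈ Matrix.unitaryGroup (ι → Bool) ℂ) (y : ι → Bool) (hχ : avgXEB γ U y ≤ χ)
    (hlog : Real.log (χ / ε) ≤ γ * (ℓ + 1)) : truncErr γ ℓ U y ≤ ε := by
  refine truncErr_le_of_avgXEB_le h0 h1 ℓ hU y hχ ?_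
  rcases hχ0.eq_or_lt with hχz | hχpos
  · rw [← hχz, mul_zero]
    exact hε.le
  have hpow : (1 - γ) ^ (ℓ + 1) ≤ Real.exp (-(γ * (ℓ + 1))) := by
    calc (1 - γ) ^ (ℓ + 1) ≤ Real.exp (-γ) ^ (ℓ + 1) :=
          pow_le_pow_left₀ (by linarith) (Real.one_sub_le_exp_neg γ) _
      _ = Real.exp (-(γ * (ℓ + 1))) := by
          rw [← Real.exp_nat_mul]
          congr 1
          push_cast
          ring
  have hexp : Real.exp (-(γ * (ℓ + 1))) ≤ ε / χ := by
    have h : Real.exp (-(γ * (ℓ + 1))) ≤ Real.exp (-Real.log (χ / ε)) :=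
      Real.exp_le_exp.2 (by linarith)
    rwa [← Real.log_inv, inv_div, Real.exp_log (div_pos hε hχpos)] at h
  calc (1 - γ) ^ (ℓ + 1) * χ ≤ ε / χ * χ := mul_le_mul_of_nonneg_right (hpow.trans hexp) hχ0
    _ = ε := div_mul_cancel₀ ε hχpos.ne'

/-- **Endpoints** (any layer matrices): `γ = 0` — the error IS the gap ((T1) is an equality); `γ = 1` —
both vanish; `ℓ ≥ n(d+1)` — every path kept, both vanish. [cite: AharonovEtAl2023, §3.1, §3.2 (n(d+1) locations), §5 (γ = 1)] -/
theorem endpointRows (γ : ℝ) (ℓ : ℕ) {d : ℕ} (U : Fin d → Matrix (ι → Bool) (ι → Bool) ℂ)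
    (y : ι → Bool) :
    truncErr 0 ℓ U y = xebGap 0 ℓ U y ∧ (truncErr 1 ℓ U y = 0 ∧ xebGap 1 ℓ U y = 0) ∧
      (Fintype.card ι * (d + 1) ≤ ℓ → truncErr γ ℓ U y = 0 ∧ xebGap γ ℓ U y = 0) := by
  refine ⟨?_, ?_, fun hℓ => ?_⟩
  · rw [truncErr_eq_tailEnum 0 ℓ U y y, xebGap_eq_tailEnum 0 ℓ U y y, sub_zero, one_pow]
  · rw [truncErr_eq_tailEnum 1 ℓ U y y, xebGap_eq_tailEnum 1 ℓ U y y, sub_self,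
      zero_pow two_ne_zero, tailEnum_zero_left]
    exact ⟨rfl, rfl⟩
  · rw [truncErr_eq_tailEnum γ ℓ U y y, xebGap_eq_tailEnum γ ℓ U y y, tailEnum_eq_zero_of_le _ hℓ,
      tailEnum_eq_zero_of_le _ hℓ]
    exact ⟨rfl, rfl⟩

/-- **(N1) sample rows** of (T4) with a mean-score bound `χ = 2·10⁻³` — `(γ, ℓ+1) = (0.1, 60)`,
`(0.05, 200)`, `(0.02, 250)` give `truncErr ≤ 4·10⁻⁶`, `10⁻⁷`, `2·10⁻⁵`; and (T3a) with `α′ = 1`,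
`ε = 10⁻⁶`: margin `√(10⁻⁶) = 10⁻³`. Arithmetic only. [cite: AharonovEtAl2023, §3.3 (ℓ ≈ γ⁻¹ log(1/ε))] -/
theorem numbers :
    (0.9 : ℝ) ^ 60 * 2e-3 ≤ 4e-6 ∧ (0.95 : ℝ) ^ 200 * 2e-3 ≤ 1e-7 ∧
      (0.98 : ℝ) ^ 250 * 2e-3 ≤ 2e-5 ∧ Real.sqrt (1 * 1e-6) = 1e-3 := by
  refine ⟨by norm_num, by norm_num, by norm_num, ?_⟩
  rw [one_mul, show (1e-6 : ℝ) = (1e-3) ^ 2 by norm_num]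
  exact Real.sqrt_sq (by norm_num)

end PauliPath

end Literature.Computability.QuantumComplexity
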